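import Literature.MathematicalPhysics.QuantumFieldTheory.Balaban1983to89.B1Eq324BenfattoSect5Eq534
import Literature.MathematicalPhysics.QuantumFieldTheory.Balaban1983to89.B1Eq324BenfattoCondLaw
import Literature.MathematicalPhysics.QuantumFieldTheory.Balaban1983to89.B1Eq324BenfattoSect5SlotMoments
import HarnessLib

/-!
# `Balaban1983to89.B1Eq324BenfattoSect5Eq515` — [BenfattoEtAl1978] §5 p. 155 / p. 159, (5.12) → (5.13) → (5.15) first line and (5.35)'s way back:
# the MEASURE-SIDE SKELETON of the product over boxes — regional small-field sets, (5.13) with conditioning-dependent observables AS AN IDENTITY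
# for arbitrary per-box weights (read forwards at (5.15), backwards at (5.35)), and the factorised lower bound
# `∫ Π_Δχ̂_Δ e^{Ĥ_J} dP̂₀ ≥ ∫ χ^{Γ₁}_{γb}e^{H_{Γ₁}}·P̄(χ_out)·Π_□(∫χ^□_b e^{Ψ_□}dP̄(·|z_{Γ₁}))dP̂₀`, PROVED for the tree's objects

statement-level skeleton of published theorems with citation tags; proofs where landed; nothing here is a claim about the
Yang–Mills mass gap

WHY THIS MODULE (cell `pub-ymgap`, seat `dag-n08-d` gen 9, INTENT-28; node N08 [Balaban1985UV3]; the [BenfattoEtAl1978] source chain behind the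
(α)-row `h324c`).  n08-b's census `N08-BCG-ASSEMBLY-MAP.md` v1 item (4) = the assembly of `BasicLemmaPrinted`, in layers: layer 1 the per-box
algebra (seat n08-b g5, `…Sect5PerBox`), layers 2–3 «product over boxes with (5.13)/(5.34)/(5.35); pavement iteration + b*» = the boxes line
(this seat).  This file is layer 2's measure-side skeleton.  Print, p. 155 (render `lit-balaban-typer/renders/benfatto1978-cmp59/bcg_p155_s3.png`,
read first-hand): *"[(5.12)] = ∫P̄(dz_{Γ₁})Π_{Δ∈Γ₁}χ̂_Δ exp H_{Γ₁}(Π_{□∩J≠∅}∫P̄(dz_□|z_{Γ₁})Π_{Δ⊂□}χ̂_Δ exp Ψ_□)·(Π_{□∩J=∅}∫P̄(dz_□|z_{Γ₁})Π_{Δ⊂□}χ̂_Δ)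
(5.13) … χ^{Γ₁}_{γb} = χ(|z_Δ| ≦ γb(1 + d(Δ,I)), ∀Δ∈Γ₁)  χ^□_b = χ(|z_Δ| ≦ b(1 + d(Δ,I)), ∀Δ ∈ □′∪Γ₂(□)) (5.14) Then [(5.12)] ≧ ∫P̄(dz_{Γ₁})χ^{Γ₁}_{γb}
exp H_{Γ₁}(Π_{□∩J=∅}∫P̄(dz_□|z_{Γ₁})χ^□_b)·(Π_{□∩J≠∅}∫P̄(dz_□|z_{Γ₁})χ^□_b exp Ψ_□χ^□_b) ≧ … (5.15)"*; p. 159: *"use the Markov property of P̄ … (5.35)"*.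

DICTIONARY.  `Π_Δχ̂_Δ` ↦ the indicator of `B1Eq324BenfattoLemma.smallFieldSet I b` (ALL tesserae, threshold `b(1 + d(I,Δ))`); `χ^{Γ₁}_{γb}`, `χ^□_b`,
and the far factors ↦ indicators of the REGIONAL sets `smallFieldOn R I c = {z | ∀ x ∈ R, |z x| ≤ c(1 + d(I, x))}` for `R = Γ₁ = corridors L w B`,
`R = □′∪Γ₂(□) = shrink L m w` (`m ∈ B`, the finite family of tesserae carrying `Ψ_□`), and `R = out B = (⋃_{m∈B} □_m)ᶜ` (print's boxes with
`□ ∩ J = ∅`, lumped into ONE `Γ₁`-enclosed far region whose integrand is a pure cut-off); `P̄(dz_□|z_{Γ₁})` ↦ `condField d α β (corridors L w B) ξ`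
(`…CondLaw`: it IS the conditional law); `Ψ_□`, a function of `z_□` AND of the conditioning values `z_{Γ₁(□)}`, is evaluated on the glued
configuration `glue Γ Ω (ξ|_Γ) (z|_Ω)` — and, since under `P̄_ξ` the `Γ₁`-coordinates equal `ξ`'s almost surely (`condField_ae_eqOn`), simply on `z`.

WHAT IS PROVED (standard axioms; no `sorry`; definition lane for the three plumbing definitions `smallFieldOn`, `out`, `glue`).
* §1 regional small-field sets: `measurableSet_smallFieldOn`, `smallFieldSet_eq_smallFieldOn_univ`, monotonicity in the region and the threshold,
  `mem_corridors_or_shrink_or_out` (the cover `Γ₁ ∪ ⋃_m(□′∪Γ₂(□_m)) ∪ out = Q₀`), ★ `prod_indicator_le_indicator_smallFieldSet` — the first `≧`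
  of (5.15): `1_{SF(I,b)} ≥ 1_{SF_{Γ₁}(I,γb)}·1_{SF_out(I,b)}·Π_{m∈B}1_{SF_{□′∪Γ₂(□_m)}(I,b)}` for `γ ≤ 1`, `0 ≤ b`.
* §2 gluing: `glue_apply_of_mem`, `glue_apply_of_mem_of_not_mem`, `glue_restrict_apply`, `measurable_glue₂` (jointly measurable),
  `hamiltonian_congr_eqOn`, `psiBox_congr_eqOn` (the Hamiltonians read the named sites only), `continuous_hamiltonian`/`measurable_hamiltonian`,
  `measurable_psiBox`.
* §3 ★ `condField_ae_eqOn` (under `P̄_ξ` the `Γ`-coordinates are `ξ`'s, a.s.), ★★ `integral_P0_prefactor_mul_prod_eq₂` — (5.13) WITH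
  CONDITIONING-DEPENDENT OBSERVABLES: `∫ h(z|_Γ)·Π_i f_i(z|_Γ, z|_{Ω_i}) dP̂₀ = ∫ h(ξ|_Γ)·Π_i [∫ f_i(ξ|_Γ, z|_{Ω_i}) dP̄_ξ(z)] dP̂₀(ξ)` for pairwise
  disjoint `Γ`-enclosed `Ω_i` and bounded jointly measurable `h`, `f_i` (n08-b's `…CondLaw.integral_condField_eq` + `…Markov.iIndepFun_condField_of_enclosed`).
* §4 boundedness on the small-field sets (`d(Δ, I) = 0` on `I` is n08-c's `…Sect5SlotMoments.distToRegion_eq_zero_of_mem`): `out_enclosed` (the far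
  region is `Γ₁`-enclosed, `w ≥ 1`), the LOCAL a-priori sizes `abs_hamiltonian_le_local` / `abs_psiBox_le_local` (the bound of `Sect5Eq534.abs_psiBox_le`
  from `|z_Δ| ≤ b` on `J ∩ □` only), `exp_hatH_eq` (`e^{Ĥ_J} = e^{H_{Γ₁}}Π_□e^{Ψ_□}`), `indicator_smallFieldOn_congr`, measurability of the cut-offs.
* §5 ★★★ `integral_boxes_factorise_eq` — (5.13) FOR THE PRODUCT OVER BOXES, AS AN IDENTITY, for ANY per-box weights `W_□` reading `□` only,
  measurable, bounded on the cut-offs' support: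
  `∫ χ^{Γ₁}_{γb}e^{H_{Γ₁}}·χ^{out}_b·Π_□(χ^{Γ₁(□)}_{γb}χ^□_b e^{W_□}) dP̂₀ = ∫ χ^{Γ₁}_{γb}(ξ)e^{H_{Γ₁}(ξ)}·[∫χ^{out}_b dP̄_ξ]·Π_□[∫ χ^{Γ₁(□)}_{γb}χ^□_b e^{W_□} dP̄_ξ] dP̂₀(ξ)`
  (`boxObs_congr`, `abs_boxObs_le`, `abs_corridorObs_le`, `integrable_boxes_integrand`).
* §6 (5.15) first line: `measurable_hatH`, `abs_cutoffBoltzmann_hatH_le`, `boxes_integrand_psiBox_le_cutoffBoltzmann` (pointwise), ★★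
  `integral_cutoff_exp_hatH_ge` : `∫ χ^{Γ₁}_{γb}e^{H_{Γ₁}}·[∫χ^{out}_b dP̄_ξ]·Π_□[∫χ^{Γ₁(□)}_{γb}χ^□_b e^{Ψ_□}dP̄_ξ] dP̂₀(ξ) ≤ ∫ Π_Δχ̂_Δ e^{Ĥ_J} dP̂₀`.
HONEST SCOPE.  The per-box lower bounds ((5.16)–(5.33); n08-b's `…Sect5Cumulant`/`…Sect5PerBox`, n08-c's `…Sect5SlotMoments`), the far-box bound of
the factor `∫χ^{out}_b dP̄_ξ`, the way back (5.35) with the (5.34) error (the sequel `…Sect5Eq535`), the cumulant bookkeeping (5.30)/(5.32), the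
pavement iteration and `b*` are NOT here; count-neutral for N08; `BasicLemmaPrinted` NOT discharged; nothing about d = 4, the continuum, OS axioms, a mass gap or the Clay problem.
-/

noncomputable section

open Finset MeasureTheory
open scoped BigOperators

namespace Literature.MathematicalPhysics.QuantumFieldTheory.Balaban1983to89.B1Eq324BenfattoSect5Eq515

open _root_.MeasureTheory _root_.ProbabilityTheory
open Literature.MathematicalPhysics.QuantumFieldTheory.Balaban1983to89.B3Sect3VectorSelfEnergy (ZSite unitVec)
open Literature.MathematicalPhysics.QuantumFieldTheory.Balaban1983to89.B1Eq324BenfattoLemma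
open Literature.MathematicalPhysics.QuantumFieldTheory.Balaban1983to89.B1Eq324BenfattoAppendixA (cubeDist_nonneg distToRegion_nonneg)
open Literature.MathematicalPhysics.QuantumFieldTheory.Balaban1983to89.B1Eq324BenfattoSect5Boxes
open Literature.MathematicalPhysics.QuantumFieldTheory.Balaban1983to89.B1Eq324BenfattoSect5Eq511
open Literature.MathematicalPhysics.QuantumFieldTheory.Balaban1983to89.B1Eq324BenfattoSect5Eq524
open Literature.MathematicalPhysics.QuantumFieldTheory.Balaban1983to89.B1Eq324BenfattoSect5Eq534
open Literature.MathematicalPhysics.QuantumFieldTheory.Balaban1983to89.B1Eq324BenfattoAppendixC2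
open Literature.MathematicalPhysics.QuantumFieldTheory.Balaban1983to89.B1Eq324BenfattoAppendixCLemma2
open Literature.MathematicalPhysics.QuantumFieldTheory.Balaban1983to89.B1Eq324BenfattoCondCentre
open Literature.MathematicalPhysics.QuantumFieldTheory.Balaban1983to89.B1Eq324BenfattoMarkov
open Literature.MathematicalPhysics.QuantumFieldTheory.Balaban1983to89.B1Eq324BenfattoDisintegration
open Literature.MathematicalPhysics.QuantumFieldTheory.Balaban1983to89.B1Eq324BenfattoCondLaw
open Literature.MathematicalPhysics.QuantumFieldTheory.Balaban1983to89.B1Eq324BenfattoSect5SlotMoments (cubeDist_self distToRegion_eq_zero_of_mem)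

variable {d : ℕ}

/-! ## §1  The regional small-field sets of (5.14) and the first `≧` of (5.15) -/

section SmallField

/-- **The regional small-field event**: `χ_R = χ(|z_Δ| ≦ c(1 + d(Δ, I)), ∀Δ ∈ R)` as the set `{z | ∀ x ∈ R, |z x| ≤ c·(1 + d(I, x))}` — (5.14)'s
`χ^{Γ₁}_{γb}` (`R = Γ₁`, `c = γb`) and `χ^□_b` (`R = □′∪Γ₂(□)`, `c = b`); `R = Q₀` is `B1Eq324BenfattoLemma.smallFieldSet`.
[cite: BenfattoEtAl1978, (5.14) p.155] -/
def smallFieldOn (R : Set (B1Eq324BenfattoLemma.Site d)) (I : Finset (B1Eq324BenfattoLemma.Site d)) (c : ℝ) :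
    Set (B1Eq324BenfattoLemma.Site d → ℝ) :=
  {z | ∀ x ∈ R, |z x| ≤ c * (1 + distToRegion I x)}

/-- The regional small-field event is measurable (a countable intersection of coordinate events). [cite: BenfattoEtAl1978, (5.14) p.155] -/
theorem measurableSet_smallFieldOn (R : Set (B1Eq324BenfattoLemma.Site d)) (I : Finset (B1Eq324BenfattoLemma.Site d)) (c : ℝ) :
    MeasurableSet (smallFieldOn R I c) := by
  have h : smallFieldOn R I c = ⋂ x : R, {z : B1Eq324BenfattoLemma.Site d → ℝ | |z x| ≤ c * (1 + distToRegion I x)} := by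
    ext z
    simp only [smallFieldOn, Set.mem_setOf_eq, Set.mem_iInter, Subtype.forall]
  rw [h]
  exact MeasurableSet.iInter fun x =>
    measurableSet_le (continuous_abs.measurable.comp (measurable_pi_apply (x : B1Eq324BenfattoLemma.Site d))) measurable_const

/-- `Π_Δχ̂_Δ` over all of `Q₀` is the regional event of the whole lattice. [cite: BenfattoEtAl1978, p.152, (5.14) p.155] -/
theorem smallFieldSet_eq_smallFieldOn_univ (I : Finset (B1Eq324BenfattoLemma.Site d)) (b : ℝ) :
    smallFieldSet I b = smallFieldOn Set.univ I b := by
  ext z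
  simp only [smallFieldSet, smallFieldOn, Set.mem_setOf_eq, Set.mem_univ, forall_const]

/-- A smaller region gives a larger event. [cite: BenfattoEtAl1978, (5.14) p.155] -/
theorem smallFieldOn_mono {R S : Set (B1Eq324BenfattoLemma.Site d)} (h : R ⊆ S) (I : Finset (B1Eq324BenfattoLemma.Site d)) (c : ℝ) :
    smallFieldOn S I c ⊆ smallFieldOn R I c := fun _ hz x hx => hz x (h hx)

/-- A smaller threshold gives a smaller event (`c ≤ c'`). [cite: BenfattoEtAl1978, (5.14)–(5.15) p.155] -/
theorem smallFieldOn_subset_of_le (R : Set (B1Eq324BenfattoLemma.Site d)) (I : Finset (B1Eq324BenfattoLemma.Site d)) {c c' : ℝ}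
    (h : c ≤ c') : smallFieldOn R I c ⊆ smallFieldOn R I c' := fun _ hz x hx =>
  (hz x hx).trans (mul_le_mul_of_nonneg_right h (by have := distToRegion_nonneg I x; positivity))

/-- **The far region**: the complement of the tesserae of the finite family `B` (print's boxes with `□ ∩ J = ∅`, lumped together).
[cite: BenfattoEtAl1978, (5.13) p.155] -/
def out (L : ℕ) (B : Finset (B1Eq324BenfattoLemma.Site d)) : Set (B1Eq324BenfattoLemma.Site d) :=
  {x | ∀ m ∈ B, x ∉ box L m}

/-- **The cover behind (5.13)**: every tessera of `Q₀` lies in the corridor network `Γ₁`, or in `□′∪Γ₂(□_m)` for some `m ∈ B`, or in the far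
region. [cite: BenfattoEtAl1978, (5.7)–(5.8) p.154–155, (5.13) p.155] -/
theorem mem_corridors_or_shrink_or_out (L w : ℕ) (B : Finset (B1Eq324BenfattoLemma.Site d)) (x : B1Eq324BenfattoLemma.Site d) :
    x ∈ corridors L w B ∨ (∃ m ∈ B, x ∈ shrink L m w) ∨ x ∈ out L B := by
  by_cases hout : x ∈ out L B
  · exact Or.inr (Or.inr hout)
  · simp only [out, Set.mem_setOf_eq, not_forall, not_not, exists_prop] at hout
    obtain ⟨m, hm, hx⟩ := hout
    by_cases hs : x ∈ shrink L m w
    · exact Or.inr (Or.inl ⟨m, hm, hs⟩)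
    · refine Or.inl (frame1_subset_corridors L w hm ?_)
      rw [frame1]
      exact Finset.mem_sdiff.mpr ⟨hx, hs⟩

/-- **THE FIRST `≧` OF (5.15), pointwise**: for `0 ≤ γ ≤ 1` and `b ≥ 0`, the product of the regional cut-offs — `χ^{Γ₁}_{γb}` on the corridors,
`χ^□_b` on each `□′∪Γ₂(□_m)` (`m ∈ B`), `χ_b` on the far region — is dominated by `Π_Δχ̂_Δ` (every site is covered, with a threshold at most
`b(1 + d(I, Δ))`). [cite: BenfattoEtAl1978, (5.14)–(5.15) p.155] -/
theorem prod_indicator_le_indicator_smallFieldSet (L w : ℕ) (B : Finset (B1Eq324BenfattoLemma.Site d))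
    (I : Finset (B1Eq324BenfattoLemma.Site d)) {γ b : ℝ} (hγ1 : γ ≤ 1) (hb : 0 ≤ b) (z : B1Eq324BenfattoLemma.Site d → ℝ) :
    (smallFieldOn (corridors L w B : Set (B1Eq324BenfattoLemma.Site d)) I (γ * b)).indicator (fun _ => (1 : ℝ)) z *
        ((smallFieldOn (out L B) I b).indicator (fun _ => (1 : ℝ)) z *
          ∏ m ∈ B, (smallFieldOn (shrink L m w : Set (B1Eq324BenfattoLemma.Site d)) I b).indicator (fun _ => (1 : ℝ)) z)
      ≤ (smallFieldSet I b).indicator (fun _ => (1 : ℝ)) z := by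
  classical
  have h01 : ∀ (S : Set (B1Eq324BenfattoLemma.Site d → ℝ)), 0 ≤ S.indicator (fun _ => (1 : ℝ)) z ∧ S.indicator (fun _ => (1 : ℝ)) z ≤ 1 :=
    fun S => ⟨Set.indicator_nonneg (fun _ _ => zero_le_one) _, Set.indicator_le_self' (fun _ _ => zero_le_one) _⟩
  by_cases hz : z ∈ smallFieldSet I b
  · rw [Set.indicator_of_mem hz]
    refine mul_le_one₀ (h01 _).2 (mul_nonneg (h01 _).1 (Finset.prod_nonneg fun m _ => (h01 _).1)) ?_
    exact mul_le_one₀ (h01 _).2 (Finset.prod_nonneg fun m _ => (h01 _).1) (Finset.prod_le_one (fun m _ => (h01 _).1) fun m _ => (h01 _).2)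
  · rw [Set.indicator_of_notMem hz]
    -- some site violates its threshold; it lies in one of the regions, whose indicator then vanishes
    simp only [smallFieldSet, Set.mem_setOf_eq, not_forall, not_le] at hz
    obtain ⟨x, hx⟩ := hz
    rcases mem_corridors_or_shrink_or_out L w B x with h1 | ⟨m, hm, h2⟩ | h3
    · have hz1 : z ∉ smallFieldOn (corridors L w B : Set (B1Eq324BenfattoLemma.Site d)) I (γ * b) := by
        intro hz1
        have h := hz1 x (Finset.mem_coe.mpr h1)
        have hγb : γ * b * (1 + distToRegion I x) ≤ b * (1 + distToRegion I x) :=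
          mul_le_mul_of_nonneg_right (by nlinarith) (by have := distToRegion_nonneg I x; positivity)
        linarith
      rw [Set.indicator_of_notMem hz1, zero_mul]
    · have hz2 : z ∉ smallFieldOn (shrink L m w : Set (B1Eq324BenfattoLemma.Site d)) I b := fun hz2 =>
        absurd (hz2 x (Finset.mem_coe.mpr h2)) (not_le.mpr hx)
      rw [Finset.prod_eq_zero hm (Set.indicator_of_notMem hz2 _), mul_zero, mul_zero]
    · have hz3 : z ∉ smallFieldOn (out L B) I b := fun hz3 => absurd (hz3 x h3) (not_le.mpr hx)
      rw [Set.indicator_of_notMem hz3, zero_mul, mul_zero]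

end SmallField

/-! ## §2  Gluing conditioning values on `Γ` with a configuration on a region `Ω`; the Hamiltonians depend on the sites they name only -/

section Glue

open scoped Classical in
/-- **Gluing**: the configuration equal to `y` on `Γ`, to `x` on `Ω ∖ Γ`, and `0` elsewhere — how an observable of `(z_{Γ₁}, z_□)` such as
`Ψ_□` is read as a function of the conditioning datum and the box configuration in (5.13). [cite: BenfattoEtAl1978, (5.13) p.155] -/
def glue (Γ : Finset (B1Eq324BenfattoLemma.Site d)) (Ω : Set (B1Eq324BenfattoLemma.Site d)) (y : Γ → ℝ) (x : Ω → ℝ) :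
    B1Eq324BenfattoLemma.Site d → ℝ :=
  fun s => if h : s ∈ Γ then y ⟨s, h⟩ else if h' : s ∈ Ω then x ⟨s, h'⟩ else 0

variable {Γ : Finset (B1Eq324BenfattoLemma.Site d)} {Ω : Set (B1Eq324BenfattoLemma.Site d)}

/-- On `Γ` the glued configuration is the conditioning datum. [cite: BenfattoEtAl1978, (5.13) p.155] -/
theorem glue_apply_of_mem (y : Γ → ℝ) (x : Ω → ℝ) {s : B1Eq324BenfattoLemma.Site d} (hs : s ∈ Γ) : glue Γ Ω y x s = y ⟨s, hs⟩ := by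
  classical
  simp only [glue, dif_pos hs]

/-- On `Ω ∖ Γ` the glued configuration is the box configuration. [cite: BenfattoEtAl1978, (5.13) p.155] -/
theorem glue_apply_of_mem_of_not_mem (y : Γ → ℝ) (x : Ω → ℝ) {s : B1Eq324BenfattoLemma.Site d} (hs : s ∈ Ω) (hs' : s ∉ Γ) :
    glue Γ Ω y x s = x ⟨s, hs⟩ := by
  classical
  simp only [glue, dif_neg hs', dif_pos hs]

/-- **Gluing the two restrictions of one configuration reproduces it on `Γ ∪ Ω`.** [cite: BenfattoEtAl1978, (5.13) p.155] -/
theorem glue_restrict_apply (z : B1Eq324BenfattoLemma.Site d → ℝ) {s : B1Eq324BenfattoLemma.Site d} (hs : s ∈ Γ ∨ s ∈ Ω) :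
    glue Γ Ω (Γ.restrict z) (fun t : Ω => z t) s = z s := by
  by_cases h : s ∈ Γ
  · rw [glue_apply_of_mem _ _ h]
    rfl
  · rw [glue_apply_of_mem_of_not_mem _ _ (hs.resolve_left h) h]

/-- The gluing map is jointly measurable. [folklore] [cite: BenfattoEtAl1978, (5.13) p.155] -/
theorem measurable_glue₂ (Γ : Finset (B1Eq324BenfattoLemma.Site d)) (Ω : Set (B1Eq324BenfattoLemma.Site d)) :
    Measurable fun p : (Γ → ℝ) × (Ω → ℝ) => glue Γ Ω p.1 p.2 := by
  classical
  refine measurable_pi_lambda _ fun s => ?_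
  by_cases h : s ∈ Γ
  · simp only [glue, dif_pos h]
    exact (measurable_pi_apply _).comp measurable_fst
  · by_cases h' : s ∈ Ω
    · simp only [glue, dif_neg h, dif_pos h']
      exact (measurable_pi_apply _).comp measurable_snd
    · simp only [glue, dif_neg h, dif_neg h']
      exact measurable_const

variable {s D : ℕ} {κ : ℝ} {a : Coef d}

/-- **`H_R` depends on the configuration only through the sites of `R`.** [cite: BenfattoEtAl1978, (5.5) p.154] -/
theorem hamiltonian_congr_eqOn (R : Finset (B1Eq324BenfattoLemma.Site d)) {z z' : B1Eq324BenfattoLemma.Site d → ℝ}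
    (h : ∀ x ∈ R, z x = z' x) : hamiltonian s D κ a R z = hamiltonian s D κ a R z' := by
  unfold hamiltonian
  refine Finset.sum_congr rfl fun p _ => Finset.sum_congr rfl fun Δ _ => Finset.sum_congr rfl fun n _ => ?_
  congr 1
  exact Finset.prod_congr rfl fun i _ => by rw [h _ (Δ i).2]

/-- **`Ψ_□` depends on the configuration only through the sites of `□`** (`□′∪Γ₂(□) ∪ Γ₁(□)`). [cite: BenfattoEtAl1978, (5.10) p.155] -/
theorem psiBox_congr_eqOn (L w : ℕ) (m : B1Eq324BenfattoLemma.Site d) {z z' : B1Eq324BenfattoLemma.Site d → ℝ}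
    (h : ∀ x ∈ box L m, z x = z' x) : psiBox s D κ a L w m z = psiBox s D κ a L w m z' := by
  have hs : ∀ x ∈ shrink L m w, z x = z' x := fun x hx => h x (shrink_subset_box L m w hx)
  have hu : ∀ x ∈ frame2 L w m ∪ frame1 L w m, z x = z' x := by
    intro x hx
    rcases Finset.mem_union.mp hx with h2 | h1
    · exact h x (shrink_subset_box L m w (by rw [frame2] at h2; exact Finset.sdiff_subset h2))
    · exact h x (by rw [frame1] at h1; exact Finset.sdiff_subset h1)
  simp only [psiBox, interaction]
  rw [hamiltonian_congr_eqOn _ hs, hamiltonian_congr_eqOn _ hu,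
    hamiltonian_congr_eqOn (frame2 L w m) (fun x hx => hu x (Finset.mem_union_left _ hx)),
    hamiltonian_congr_eqOn (frame1 L w m) (fun x hx => hu x (Finset.mem_union_right _ hx))]

/-- `H_R` is a continuous (polynomial) function of the configuration. [cite: BenfattoEtAl1978, (5.5) p.154] -/
theorem continuous_hamiltonian (R : Finset (B1Eq324BenfattoLemma.Site d)) : Continuous fun z => hamiltonian s D κ a R z := by
  unfold hamiltonian
  refine continuous_finsetSum _ fun p _ => continuous_finsetSum _ fun Δ _ => continuous_finsetSum _ fun n _ => ?_
  exact continuous_const.mul (continuous_finsetProd _ fun i _ => (continuous_apply _).pow _)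

/-- `H_R` is measurable. [cite: BenfattoEtAl1978, (5.5) p.154] -/
theorem measurable_hamiltonian (R : Finset (B1Eq324BenfattoLemma.Site d)) : Measurable fun z => hamiltonian s D κ a R z :=
  (continuous_hamiltonian R).measurable

/-- `Ψ_□` is measurable. [cite: BenfattoEtAl1978, (5.10) p.155] -/
theorem measurable_psiBox (L w : ℕ) (m : B1Eq324BenfattoLemma.Site d) : Measurable fun z => psiBox s D κ a L w m z := by
  unfold psiBox interaction
  exact (measurable_hamiltonian _).add (((measurable_hamiltonian _).sub (measurable_hamiltonian _)).sub (measurable_hamiltonian _))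

end Glue

/-! ## §3  (5.13) with conditioning-dependent observables -/

section Factorisation

variable {α β : ℝ}

/-- **Under `P̄_ξ = P̂₀(dz | z̄_Γ = ξ|_Γ)` the `Γ`-coordinates ARE the conditioning values, almost surely**: `z_c = ξ_c` for all `c ∈ Γ`,
`P̄_ξ`-a.s. (the conditioned field is `u(ξ) + ζ` with `u(ξ)_c = ξ_c` and `ζ_c = 0` a.s. on `Γ`; n08-b's `…CondLaw.schurField_eval_ae_eq_zero`).
[cite: BenfattoEtAl1978, p.152 «P̂₀(dz|(z̄_Δ)_{Δ∈C})»; Appendix C (C.7) p.164] -/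
theorem condField_ae_eqOn (hα : 0 < α) (hβ : 0 < β) (Γ : Finset (B1Eq324BenfattoLemma.Site d)) (ξ : B1Eq324BenfattoLemma.Site d → ℝ) :
    ∀ᵐ z ∂condField d α β Γ ξ, ∀ c ∈ Γ, z c = ξ c := by
  have hKc := isPosSemidefKernel_condCov_freeCov (d := d) hα hβ Γ
  set Q := gaussianFieldOfKernel (condCov (freeCov d α β) Γ) with hQ
  set T : (B1Eq324BenfattoLemma.Site d → ℝ) → (B1Eq324BenfattoLemma.Site d → ℝ) :=
    fun ζ x => condMean (freeCov d α β) Γ ξ x + ζ x with hT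
  have hTm : Measurable T := measurable_pi_lambda _ fun x => measurable_const.add (measurable_pi_apply x)
  have hcf : condField d α β Γ ξ = Q.map T := rfl
  rw [hcf, ae_map_iff hTm.aemeasurable]
  · have hdet := isUnit_det_covGram_freeCov (d := d) hα hβ Γ
    have hall : ∀ c ∈ Γ, ∀ᵐ ζ ∂Q, T ζ c = ξ c := by
      intro c hc
      filter_upwards [schurField_eval_ae_eq_zero hα hβ Γ hc] with ζ hζ
      simp only [hT, hζ, add_zero]
      exact condMean_apply_of_mem (freeCov d α β) Γ ξ hdet hc
    exact (ae_ball_iff (Finset.countable_toSet Γ)).2 hall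
  · have hset : {z : B1Eq324BenfattoLemma.Site d → ℝ | ∀ c ∈ Γ, z c = ξ c} =
        ⋂ c ∈ (Γ : Set (B1Eq324BenfattoLemma.Site d)), {z : B1Eq324BenfattoLemma.Site d → ℝ | z c = ξ c} := by
      ext z
      simp only [Set.mem_setOf_eq, Set.mem_iInter, Finset.mem_coe]
    rw [hset]
    exact MeasurableSet.biInter (Finset.countable_toSet Γ) fun c _ =>
      measurableSet_eq_fun (measurable_pi_apply (X := fun _ : B1Eq324BenfattoLemma.Site d => ℝ) c) measurable_const

/-- **(5.13) WITH CONDITIONING-DEPENDENT OBSERVABLES** — p. 155, *"∫P̄(dz_{Γ₁}) Π_{Δ∈Γ₁}χ̂_Δ exp H_{Γ₁} (Π_□ ∫P̄(dz_□|z_{Γ₁}) Π_{Δ⊂□}χ̂_Δ exp Ψ_□)"*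
(each `Ψ_□` depends on `z_□` AND on the conditioning values `z_{Γ₁(□)}`).  PROVED for the tree's objects: for finitely many pairwise disjoint
`Γ`-enclosed regions `Ω_i`, a bounded measurable prefactor `h` of `z|_Γ` and bounded jointly measurable observables `f_i(z|_Γ, z|_{Ω_i})`,
`∫ h(z|_Γ)·Π_i f_i(z|_Γ, z|_{Ω_i}) dP̂₀(z) = ∫ h(ξ|_Γ)·Π_i [∫ f_i(ξ|_Γ, z|_{Ω_i}) dP̄_ξ(z)] dP̂₀(ξ)` — the disintegration
(`…CondLaw.integral_condField_eq`) followed by the conditional independence of the box fields (`…Markov.iIndepFun_condField_of_enclosed`).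
[cite: BenfattoEtAl1978, §5 (5.13) p.155] -/
theorem integral_P0_prefactor_mul_prod_eq₂ (hα : 0 < α) (hβ : 0 < β) (Γ : Finset (B1Eq324BenfattoLemma.Site d)) {ι : Type*} [Fintype ι]
    {Ω : ι → Set (B1Eq324BenfattoLemma.Site d)} (hΩΓ : ∀ i, ∀ z ∈ Ω i, z ∉ Γ)
    (hΩ : ∀ i, ∀ z ∈ Ω i, ∀ μ : Fin d,
      (z + unitVec μ ∈ Ω i ∨ z + unitVec μ ∈ Γ) ∧ (z - unitVec μ ∈ Ω i ∨ z - unitVec μ ∈ Γ))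
    (hdisj : ∀ i j, i ≠ j → Disjoint (Ω i) (Ω j))
    (h : (Γ → ℝ) → ℝ) (hh : Measurable h) {Mh : ℝ} (hMh : ∀ y, |h y| ≤ Mh)
    (f : (i : ι) → (Γ → ℝ) × ((Ω i) → ℝ) → ℝ) (hf : ∀ i, Measurable (f i)) {M : ι → ℝ} (hM : ∀ i q, |f i q| ≤ M i) :
    ∫ z, h (Γ.restrict z) * ∏ i, f i (Γ.restrict z, fun t : Ω i => z t) ∂P0 d α β
      = ∫ ξ, h (Γ.restrict ξ) * ∏ i, (∫ z, f i (Γ.restrict ξ, fun t : Ω i => z t) ∂condField d α β Γ ξ) ∂P0 d α β := by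
  have hXm : ∀ i, Measurable fun (z : B1Eq324BenfattoLemma.Site d → ℝ) (t : Ω i) => z t :=
    fun i => measurable_pi_lambda _ fun t => measurable_pi_apply _
  -- the bounded measurable integrand `g(y, z) = h(y)·Π_i f_i(y, z|_{Ω_i})`
  set g : (Γ → ℝ) × (B1Eq324BenfattoLemma.Site d → ℝ) → ℝ := fun q => h q.1 * ∏ i, f i (q.1, fun t : Ω i => q.2 t) with hg
  have hgm : Measurable g :=
    (hh.comp measurable_fst).mul (Finset.measurable_prod _ fun i _ => (hf i).comp (measurable_fst.prodMk ((hXm i).comp measurable_snd)))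
  have hbound : ∀ q : (Γ → ℝ) × (B1Eq324BenfattoLemma.Site d → ℝ), |g q| ≤ Mh * ∏ i, M i := by
    intro q
    simp only [hg]
    rw [abs_mul, Finset.abs_prod]
    exact mul_le_mul (hMh _) (Finset.prod_le_prod (fun i _ => abs_nonneg _) fun i _ => hM i _)
      (Finset.prod_nonneg fun i _ => abs_nonneg _) ((abs_nonneg _).trans (hMh q.1))
  have htower := integral_condField_eq (d := d) hα hβ Γ hgm hbound
  simp only [hg] at htower
  rw [htower]
  refine integral_congr_ae (Filter.Eventually.of_forall fun ξ => ?_)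
  show ∫ z, h (Γ.restrict ξ) * ∏ i, f i (Γ.restrict ξ, fun t : Ω i => z t) ∂condField d α β Γ ξ = _
  rw [integral_const_mul]
  congr 1
  exact (iIndepFun_condField_of_enclosed hα hβ Γ hΩΓ hΩ hdisj ξ).integral_fun_prod_comp
    (fun i => (hXm i).aemeasurable) fun i => ((hf i).comp (measurable_const.prodMk measurable_id)).aestronglyMeasurable

end Factorisation

/-! ## §4  Boundedness of the Hamiltonians on the small-field sets; the far region is enclosed -/

section Bounded

/-- **The far region is enclosed by the corridors** (`w ≥ 1`, `L ≥ 1`): a lattice neighbour of a site outside every tessera of `B` is outside them too,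
or lies in the outer corridor `Γ₁(□_m)` of the tessera it enters. [cite: BenfattoEtAl1978, (5.7)–(5.8) p.154–155, (5.13) p.155] -/
theorem out_enclosed {L w : ℕ} (hw : 1 ≤ w) (B : Finset (B1Eq324BenfattoLemma.Site d)) :
    ∀ z ∈ out L B, ∀ μ : Fin d,
      (z + unitVec μ ∈ out L B ∨ z + unitVec μ ∈ corridors L w B) ∧ (z - unitVec μ ∈ out L B ∨ z - unitVec μ ∈ corridors L w B) := by
  intro z hz μ
  -- a neighbour of a site at depth `≥ w ≥ 1` of `□_m` lies in `□_m`
  have hnbr : ∀ {m y : B1Eq324BenfattoLemma.Site d}, y ∈ shrink L m w → y + unitVec μ ∈ box L m ∧ y - unitVec μ ∈ box L m := by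
    intro m y hy
    rw [mem_shrink_iff] at hy
    rw [mem_box_iff, mem_box_iff]
    have hw' : (1 : ℤ) ≤ w := by exact_mod_cast hw
    constructor
    · intro i
      obtain ⟨h1, h2⟩ := hy i
      simp only [Pi.add_apply, unitVec, Pi.single_apply]
      split_ifs <;> constructor <;> linarith
    · intro i
      obtain ⟨h1, h2⟩ := hy i
      simp only [Pi.sub_apply, unitVec, Pi.single_apply]
      split_ifs <;> constructor <;> linarith
  -- a neighbour `y` of `z`: either outside every box of `B`, or in some box `m ∈ B`; in the latter case `y ∉ shrink m w` (else `z`, a neighbour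
  -- of a site at depth `≥ w ≥ 1`, would lie in `□_m`), so `y ∈ Γ₁(□_m) ⊆ Γ₁`
  have key : ∀ y : B1Eq324BenfattoLemma.Site d, (y + unitVec μ = z ∨ y - unitVec μ = z) → y ∈ out L B ∨ y ∈ corridors L w B := by
    intro y hy
    by_cases hout : y ∈ out L B
    · exact Or.inl hout
    · right
      simp only [out, Set.mem_setOf_eq, not_forall, not_not, exists_prop] at hout
      obtain ⟨m, hm, hyb⟩ := hout
      refine frame1_subset_corridors L w hm ?_
      rw [frame1, Finset.mem_sdiff]
      refine ⟨hyb, fun hys => ?_⟩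
      have hnb := hnbr hys
      rcases hy with h | h
      · exact hz m hm (h ▸ hnb.1)
      · exact hz m hm (h ▸ hnb.2)
  exact ⟨key (z + unitVec μ) (Or.inr (add_sub_cancel_right z _)), key (z - unitVec μ) (Or.inl (sub_add_cancel z _))⟩

variable {s D : ℕ} {κ : ℝ} {a : Coef d} {J : Finset (B1Eq324BenfattoLemma.Site d)}

/-- **Local form of `Sect5Eq534.abs_hamiltonian_le`**: the bound `|H_R(z)| ≤ s₁·A·b^D·|R|` needs `|z_Δ| ≤ b` only for `Δ ⊂ J ∩ R` (`H_R` reads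
no other coordinate). [cite: BenfattoEtAl1978, (5.5) p.154, (5.15) p.155] -/
theorem abs_hamiltonian_le_local (hκ : 0 < κ) (hJ : CoefSupportedIn a J) {A : ℝ} (hA0 : 0 ≤ A)
    (hA : ∀ p ∈ Finset.Icc 1 s, ∀ (Δ : Fin p → B1Eq324BenfattoLemma.Site d), (∀ i, Δ i ∈ J) →
      ∀ n ∈ admissible p D, |a p Δ n| ≤ A)
    (R : Finset (B1Eq324BenfattoLemma.Site d)) {z : B1Eq324BenfattoLemma.Site d → ℝ} {b : ℝ} (hb : 1 ≤ b)
    (hz : ∀ x ∈ J, x ∈ R → |z x| ≤ b) :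
    |hamiltonian s D κ a R z| ≤ s1Const s D d κ * A * b ^ D * R.card := by
  classical
  set z' : B1Eq324BenfattoLemma.Site d → ℝ := fun x => if x ∈ R then z x else 0 with hz'
  rw [hamiltonian_congr_eqOn R (z' := z') (fun x hx => by simp only [hz', if_pos hx])]
  refine abs_hamiltonian_le hκ hJ hA0 hA R hb fun x hx => ?_
  by_cases hxR : x ∈ R
  · simp only [hz', if_pos hxR]
    exact hz x hx hxR
  · simp only [hz', if_neg hxR, abs_zero]
    linarith

/-- **Local form of `Sect5Eq534.abs_psiBox_le`** ((5.15) i)): `|Ψ_□(z)| ≤ 2s₁·A·b^D·L^d` needs `|z_Δ| ≤ b` only for `Δ ⊂ J ∩ □`.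
[cite: BenfattoEtAl1978, (5.15) p.155] -/
theorem abs_psiBox_le_local (hκ : 0 < κ) (hJ : CoefSupportedIn a J) {A : ℝ} (hA0 : 0 ≤ A)
    (hA : ∀ p ∈ Finset.Icc 1 s, ∀ (Δ : Fin p → B1Eq324BenfattoLemma.Site d), (∀ i, Δ i ∈ J) →
      ∀ n ∈ admissible p D, |a p Δ n| ≤ A)
    {L w : ℕ} {m : B1Eq324BenfattoLemma.Site d} {z : B1Eq324BenfattoLemma.Site d → ℝ} {b : ℝ} (hb : 1 ≤ b)
    (hz : ∀ x ∈ J, x ∈ box L m → |z x| ≤ b) :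
    |psiBox s D κ a L w m z| ≤ 2 * s1Const s D d κ * A * b ^ D * (L : ℝ) ^ d := by
  classical
  set z' : B1Eq324BenfattoLemma.Site d → ℝ := fun x => if x ∈ box L m then z x else 0 with hz'
  rw [psiBox_congr_eqOn L w m (z' := z') (fun x hx => by simp only [hz', if_pos hx])]
  refine abs_psiBox_le hκ hJ hA0 hA hb fun x hx => ?_
  by_cases hxR : x ∈ box L m
  · simp only [hz', if_pos hxR]
    exact hz x hx hxR
  · simp only [hz', if_neg hxR, abs_zero]
    linarith

/-- `exp Ĥ_J = exp H_{Γ₁} · Π_□ exp Ψ_□` ((5.9)). [cite: BenfattoEtAl1978, (5.9) p.155] -/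
theorem exp_hatH_eq (L w : ℕ) (B : Finset (B1Eq324BenfattoLemma.Site d)) (z : B1Eq324BenfattoLemma.Site d → ℝ) :
    Real.exp (hatH s D κ a L w B z) = Real.exp (hamiltonian s D κ a (corridors L w B) z) * ∏ m ∈ B, Real.exp (psiBox s D κ a L w m z) := by
  rw [hatH, Real.exp_add, Real.exp_sum]

/-- The regional cut-off reads the region's coordinates only. [cite: BenfattoEtAl1978, (5.14) p.155] -/
theorem indicator_smallFieldOn_congr {R : Set (B1Eq324BenfattoLemma.Site d)} (I : Finset (B1Eq324BenfattoLemma.Site d)) (c : ℝ)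
    {z z' : B1Eq324BenfattoLemma.Site d → ℝ} (h : ∀ x ∈ R, z x = z' x) :
    (smallFieldOn R I c).indicator (fun _ => (1 : ℝ)) z = (smallFieldOn R I c).indicator (fun _ => (1 : ℝ)) z' := by
  have hiff : z ∈ smallFieldOn R I c ↔ z' ∈ smallFieldOn R I c := by
    simp only [smallFieldOn, Set.mem_setOf_eq]
    exact ⟨fun hz x hx => h x hx ▸ hz x hx, fun hz x hx => (h x hx).symm ▸ hz x hx⟩
  by_cases hz : z ∈ smallFieldOn R I c
  · rw [Set.indicator_of_mem hz, Set.indicator_of_mem (hiff.mp hz)]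
  · rw [Set.indicator_of_notMem hz, Set.indicator_of_notMem (fun h' => hz (hiff.mpr h'))]

/-- The cut-off indicators are measurable functions. [cite: BenfattoEtAl1978, (5.14) p.155] -/
theorem measurable_indicator_smallFieldOn (R : Set (B1Eq324BenfattoLemma.Site d)) (I : Finset (B1Eq324BenfattoLemma.Site d)) (c : ℝ) :
    Measurable fun z : B1Eq324BenfattoLemma.Site d → ℝ => (smallFieldOn R I c).indicator (fun _ => (1 : ℝ)) z :=
  measurable_const.indicator (measurableSet_smallFieldOn R I c)

/-- The cut-off indicators take values in `[0, 1]`. [cite: BenfattoEtAl1978, (5.14) p.155] -/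
theorem indicator_smallFieldOn_mem_Icc (R : Set (B1Eq324BenfattoLemma.Site d)) (I : Finset (B1Eq324BenfattoLemma.Site d)) (c : ℝ)
    (z : B1Eq324BenfattoLemma.Site d → ℝ) :
    0 ≤ (smallFieldOn R I c).indicator (fun _ => (1 : ℝ)) z ∧ (smallFieldOn R I c).indicator (fun _ => (1 : ℝ)) z ≤ 1 :=
  ⟨Set.indicator_nonneg (fun _ _ => zero_le_one) _, Set.indicator_le_self' (fun _ _ => zero_le_one) _⟩

end Bounded

/-! ## §5  (5.13) for the product over boxes: the factorisation IDENTITY with a general per-box weight -/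

section Main

variable {α β : ℝ} {s D : ℕ} {κ : ℝ} {a : Coef d} {J I : Finset (B1Eq324BenfattoLemma.Site d)} {L w : ℕ}
  {B : Finset (B1Eq324BenfattoLemma.Site d)} {γ b A : ℝ}

/-- **A per-box observable `χ^{Γ₁(□)}_{γb}·χ^□_b·e^{W_□}` reads `□` only** when the weight `W_□` does. [cite: BenfattoEtAl1978, (5.13)–(5.15) p.155] -/
theorem boxObs_congr (I : Finset (B1Eq324BenfattoLemma.Site d)) (γ b : ℝ) (L w : ℕ) (m : B1Eq324BenfattoLemma.Site d)
    {W : (B1Eq324BenfattoLemma.Site d → ℝ) → ℝ} (hW : ∀ z z' : B1Eq324BenfattoLemma.Site d → ℝ, (∀ x ∈ box L m, z x = z' x) → W z = W z')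
    {z z' : B1Eq324BenfattoLemma.Site d → ℝ} (h : ∀ x ∈ box L m, z x = z' x) :
    (smallFieldOn (frame1 L w m : Set (B1Eq324BenfattoLemma.Site d)) I (γ * b)).indicator (fun _ => (1 : ℝ)) z *
        (smallFieldOn (shrink L m w : Set (B1Eq324BenfattoLemma.Site d)) I b).indicator (fun _ => (1 : ℝ)) z * Real.exp (W z) =
      (smallFieldOn (frame1 L w m : Set (B1Eq324BenfattoLemma.Site d)) I (γ * b)).indicator (fun _ => (1 : ℝ)) z' *
        (smallFieldOn (shrink L m w : Set (B1Eq324BenfattoLemma.Site d)) I b).indicator (fun _ => (1 : ℝ)) z' * Real.exp (W z') := by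
  rw [indicator_smallFieldOn_congr I (γ * b) (fun x hx => h x (by rw [Finset.mem_coe, frame1] at hx; exact Finset.sdiff_subset hx)),
    indicator_smallFieldOn_congr I b (fun x hx => h x (shrink_subset_box L m w (Finset.mem_coe.mp hx))), hW z z' h]

/-- **A per-box observable is bounded** by `e^{K}` when `|W_□(z)| ≤ K` on its support (`|z_Δ| ≤ b` on `J ∩ □`, as `γ ≤ 1` and `d(I, Δ) = 0` on `J ⊆ I`).
[cite: BenfattoEtAl1978, (5.15) i) p.155] -/
theorem abs_boxObs_le (hJI : J ⊆ I) (hγ : γ ≤ 1) (hb : 0 ≤ b) (m : B1Eq324BenfattoLemma.Site d)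
    {W : (B1Eq324BenfattoLemma.Site d → ℝ) → ℝ} {K : ℝ}
    (hWb : ∀ z : B1Eq324BenfattoLemma.Site d → ℝ, (∀ x ∈ J, x ∈ box L m → |z x| ≤ b) → |W z| ≤ K) (z : B1Eq324BenfattoLemma.Site d → ℝ) :
    |(smallFieldOn (frame1 L w m : Set (B1Eq324BenfattoLemma.Site d)) I (γ * b)).indicator (fun _ => (1 : ℝ)) z *
        (smallFieldOn (shrink L m w : Set (B1Eq324BenfattoLemma.Site d)) I b).indicator (fun _ => (1 : ℝ)) z * Real.exp (W z)| ≤ Real.exp K := by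
  by_cases h1 : z ∈ smallFieldOn (frame1 L w m : Set (B1Eq324BenfattoLemma.Site d)) I (γ * b)
  swap
  · rw [Set.indicator_of_notMem h1, zero_mul, zero_mul, abs_zero]
    exact (Real.exp_pos _).le
  by_cases h2 : z ∈ smallFieldOn (shrink L m w : Set (B1Eq324BenfattoLemma.Site d)) I b
  swap
  · rw [Set.indicator_of_notMem h2, mul_zero, zero_mul, abs_zero]
    exact (Real.exp_pos _).le
  rw [Set.indicator_of_mem h1, Set.indicator_of_mem h2, one_mul, one_mul, Real.abs_exp, Real.exp_le_exp]
  refine (le_abs_self _).trans (hWb z fun x hx hxb => ?_)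
  by_cases hxs : x ∈ shrink L m w
  · have h := h2 x (Finset.mem_coe.mpr hxs)
    rwa [distToRegion_eq_zero_of_mem (hJI hx), add_zero, mul_one] at h
  · have hxf : x ∈ (frame1 L w m : Set (B1Eq324BenfattoLemma.Site d)) := by
      rw [Finset.mem_coe, frame1]
      exact Finset.mem_sdiff.mpr ⟨hxb, hxs⟩
    have h := h1 x hxf
    rw [distToRegion_eq_zero_of_mem (hJI hx), add_zero, mul_one] at h
    exact h.trans (by nlinarith)

/-- **The corridor prefactor `χ^{Γ₁}_{γb}·e^{H_{Γ₁}}` is bounded** by `e^{s₁Ab^D|Γ₁|}`. [cite: BenfattoEtAl1978, (5.13) p.155] -/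
theorem abs_corridorObs_le (hκ : 0 < κ) (hJ : CoefSupportedIn a J) (hA0 : 0 ≤ A)
    (hA : ∀ p ∈ Finset.Icc 1 s, ∀ (Δ : Fin p → B1Eq324BenfattoLemma.Site d), (∀ i, Δ i ∈ J) →
      ∀ n ∈ admissible p D, |a p Δ n| ≤ A)
    (hJI : J ⊆ I) (hγ : γ ≤ 1) (hb : 1 ≤ b) (Γ : Finset (B1Eq324BenfattoLemma.Site d)) (z : B1Eq324BenfattoLemma.Site d → ℝ) :
    |(smallFieldOn (Γ : Set (B1Eq324BenfattoLemma.Site d)) I (γ * b)).indicator (fun _ => (1 : ℝ)) z *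
        Real.exp (hamiltonian s D κ a Γ z)| ≤ Real.exp (s1Const s D d κ * A * b ^ D * Γ.card) := by
  by_cases h1 : z ∈ smallFieldOn (Γ : Set (B1Eq324BenfattoLemma.Site d)) I (γ * b)
  swap
  · rw [Set.indicator_of_notMem h1, zero_mul, abs_zero]
    exact (Real.exp_pos _).le
  rw [Set.indicator_of_mem h1, one_mul, Real.abs_exp, Real.exp_le_exp]
  refine (le_abs_self _).trans (abs_hamiltonian_le_local hκ hJ hA0 hA Γ hb fun x hx hxΓ => ?_)
  have h := h1 x (Finset.mem_coe.mpr hxΓ)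
  rw [distToRegion_eq_zero_of_mem (hJI hx), add_zero, mul_one] at h
  exact h.trans (by nlinarith)

/-- A site of the far region is not a corridor site. [cite: BenfattoEtAl1978, (5.8) p.155] -/
theorem not_mem_corridors_of_mem_out {z : B1Eq324BenfattoLemma.Site d} (hz : z ∈ out L B) : z ∉ corridors L w B := by
  intro h
  rw [corridors, Finset.mem_biUnion] at h
  obtain ⟨m, hm, hzm⟩ := h
  rw [frame1] at hzm
  exact hz m hm (Finset.sdiff_subset hzm)

/-- **(5.13) FOR THE PRODUCT OVER BOXES — THE FACTORISATION IDENTITY.**  For the corridor network `Γ₁ = corridors L w B` (`L, w ≥ 1`), `P̄_ξ =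
condField d α β Γ₁ ξ`, cut-offs `χ^{Γ₁}_{γb}`, `χ^□_b`, `χ^{out}_b` (`γ ≤ 1 ≤ b`, `J ⊆ I`) and ANY per-box weights `W_□` reading `□` only, measurable and
bounded on the support of the box cut-offs:
`∫ χ^{Γ₁}_{γb} e^{H_{Γ₁}} · χ^{out}_b · Π_{□∈B}(χ^{Γ₁(□)}_{γb} χ^□_b e^{W_□}) dP̂₀ = ∫ χ^{Γ₁}_{γb}(ξ) e^{H_{Γ₁}(ξ)} · [∫ χ^{out}_b dP̄_ξ] · Π_□[∫ χ^{Γ₁(□)}_{γb} χ^□_b e^{W_□} dP̄_ξ] dP̂₀(ξ)`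
— print's (5.13) read in both directions ((5.15): `W_□ = Ψ_□`; (5.35): `W_□ = Ψ′₁ + Ψ₂`, «use the Markov property»).  Mechanism: §3's disintegration with
independence for the observables read through `glue`, and `z_{Γ₁} = ξ_{Γ₁}` `P̄_ξ`-a.s. to remove the gluing. [cite: BenfattoEtAl1978, §5 (5.13) p.155, (5.35) p.159] -/
theorem integral_boxes_factorise_eq (hα : 0 < α) (hβ : 0 < β) (hκ : 0 < κ) (hJ : CoefSupportedIn a J) (hA0 : 0 ≤ A)
    (hA : ∀ p ∈ Finset.Icc 1 s, ∀ (Δ : Fin p → B1Eq324BenfattoLemma.Site d), (∀ i, Δ i ∈ J) →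
      ∀ n ∈ admissible p D, |a p Δ n| ≤ A)
    (hJI : J ⊆ I) (hL : 0 < L) (hw : 1 ≤ w) (B : Finset (B1Eq324BenfattoLemma.Site d)) (hγ : γ ≤ 1) (hb : 1 ≤ b)
    (W : B1Eq324BenfattoLemma.Site d → (B1Eq324BenfattoLemma.Site d → ℝ) → ℝ)
    (hWdep : ∀ m, ∀ z z' : B1Eq324BenfattoLemma.Site d → ℝ, (∀ x ∈ box L m, z x = z' x) → W m z = W m z')
    (hWm : ∀ m, Measurable (W m)) {K : ℝ}
    (hWb : ∀ m, ∀ z : B1Eq324BenfattoLemma.Site d → ℝ, (∀ x ∈ J, x ∈ box L m → |z x| ≤ b) → |W m z| ≤ K) :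
    ∫ z, (smallFieldOn (corridors L w B : Set (B1Eq324BenfattoLemma.Site d)) I (γ * b)).indicator (fun _ => (1 : ℝ)) z *
          Real.exp (hamiltonian s D κ a (corridors L w B) z) *
        ((smallFieldOn (out L B) I b).indicator (fun _ => (1 : ℝ)) z *
          ∏ m ∈ B, (smallFieldOn (frame1 L w m : Set (B1Eq324BenfattoLemma.Site d)) I (γ * b)).indicator (fun _ => (1 : ℝ)) z *
              (smallFieldOn (shrink L m w : Set (B1Eq324BenfattoLemma.Site d)) I b).indicator (fun _ => (1 : ℝ)) z * Real.exp (W m z)) ∂P0 d α β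
      = ∫ ξ, (smallFieldOn (corridors L w B : Set (B1Eq324BenfattoLemma.Site d)) I (γ * b)).indicator (fun _ => (1 : ℝ)) ξ *
          Real.exp (hamiltonian s D κ a (corridors L w B) ξ) *
        ((∫ z, (smallFieldOn (out L B) I b).indicator (fun _ => (1 : ℝ)) z ∂condField d α β (corridors L w B) ξ) *
          ∏ m ∈ B, ∫ z, (smallFieldOn (frame1 L w m : Set (B1Eq324BenfattoLemma.Site d)) I (γ * b)).indicator (fun _ => (1 : ℝ)) z *
              (smallFieldOn (shrink L m w : Set (B1Eq324BenfattoLemma.Site d)) I b).indicator (fun _ => (1 : ℝ)) z *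
              Real.exp (W m z) ∂condField d α β (corridors L w B) ξ) ∂P0 d α β := by
  classical
  haveI : IsProbabilityMeasure (P0 d α β) := isProbabilityMeasure_P0 hα hβ
  set Γ : Finset (B1Eq324BenfattoLemma.Site d) := corridors L w B with hΓ
  -- the regions: the far region and the insides `□′∪Γ₂(□_m)` of the tesserae of `B`
  set Ω : Option B → Set (B1Eq324BenfattoLemma.Site d) :=
    fun i => i.elim (out L B) fun m => ((shrink L (m : B1Eq324BenfattoLemma.Site d) w : Finset (B1Eq324BenfattoLemma.Site d)) :
      Set (B1Eq324BenfattoLemma.Site d)) with hΩ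
  -- the observables, as functions of the full configuration
  set Fobs : Option B → (B1Eq324BenfattoLemma.Site d → ℝ) → ℝ := fun i z =>
    i.elim ((smallFieldOn (out L B) I b).indicator (fun _ => (1 : ℝ)) z) fun m =>
      (smallFieldOn (frame1 L w (m : B1Eq324BenfattoLemma.Site d) : Set (B1Eq324BenfattoLemma.Site d)) I (γ * b)).indicator
          (fun _ => (1 : ℝ)) z *
        (smallFieldOn (shrink L (m : B1Eq324BenfattoLemma.Site d) w : Set (B1Eq324BenfattoLemma.Site d)) I b).indicator (fun _ => (1 : ℝ)) z *
        Real.exp (W (m : B1Eq324BenfattoLemma.Site d) z) with hFobs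
  set Hpre : (B1Eq324BenfattoLemma.Site d → ℝ) → ℝ := fun z =>
    (smallFieldOn (Γ : Set (B1Eq324BenfattoLemma.Site d)) I (γ * b)).indicator (fun _ => (1 : ℝ)) z *
      Real.exp (hamiltonian s D κ a Γ z) with hHpre
  set x0 : ((∅ : Set (B1Eq324BenfattoLemma.Site d)) → ℝ) := fun _ => 0 with hx0
  set h : (Γ → ℝ) → ℝ := fun y => Hpre (glue Γ ∅ y x0) with hh
  set f : (i : Option B) → (Γ → ℝ) × ((Ω i) → ℝ) → ℝ := fun i q => Fobs i (glue Γ (Ω i) q.1 q.2) with hf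
  -- (F1)/(F2): the observables read only `Γ` and their region
  have hF1 : ∀ z, h (Γ.restrict z) = Hpre z := by
    intro z
    have hagree : ∀ x ∈ (Γ : Set (B1Eq324BenfattoLemma.Site d)), glue Γ ∅ (Γ.restrict z) x0 x = z x := fun x hx => by
      rw [glue_apply_of_mem _ _ (Finset.mem_coe.mp hx)]
      rfl
    simp only [hh, hHpre]
    rw [indicator_smallFieldOn_congr I (γ * b) hagree, hamiltonian_congr_eqOn Γ (fun x hx => hagree x (Finset.mem_coe.mpr hx))]
  have hF2 : ∀ i z, Fobs i (glue Γ (Ω i) (Γ.restrict z) (fun t : Ω i => z t)) = Fobs i z := by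
    rintro (_ | m) z
    · simp only [hFobs, Option.elim]
      exact indicator_smallFieldOn_congr I b fun x hx => glue_restrict_apply z (Or.inr hx)
    · simp only [hFobs, Option.elim]
      refine boxObs_congr I γ b L w (m : B1Eq324BenfattoLemma.Site d) (hWdep (m : B1Eq324BenfattoLemma.Site d)) fun x hx =>
        glue_restrict_apply z ?_
      by_cases hxs : x ∈ shrink L (m : B1Eq324BenfattoLemma.Site d) w
      · exact Or.inr (Finset.mem_coe.mpr hxs)
      · left
        refine frame1_subset_corridors L w m.2 ?_
        rw [frame1]
        exact Finset.mem_sdiff.mpr ⟨hx, hxs⟩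
  -- measurability and bounds
  have hHpre_m : Measurable Hpre :=
    (measurable_indicator_smallFieldOn _ I (γ * b)).mul (measurable_hamiltonian Γ).exp
  have hFobs_m : ∀ i, Measurable (Fobs i) := by
    rintro (_ | m)
    · exact measurable_indicator_smallFieldOn _ I b
    · exact ((measurable_indicator_smallFieldOn _ I (γ * b)).mul (measurable_indicator_smallFieldOn _ I b)).mul
        (hWm (m : B1Eq324BenfattoLemma.Site d)).exp
  have hpair : Measurable fun y : Γ → ℝ => (y, x0) := measurable_id.prodMk measurable_const
  have hh_m : Measurable h := hHpre_m.comp ((measurable_glue₂ Γ ∅).comp hpair)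
  have hf_m : ∀ i, Measurable (f i) := fun i => (hFobs_m i).comp (measurable_glue₂ Γ (Ω i))
  have hh_b : ∀ y, |h y| ≤ Real.exp (s1Const s D d κ * A * b ^ D * Γ.card) := fun y =>
    abs_corridorObs_le hκ hJ hA0 hA hJI hγ hb Γ _
  set M : Option B → ℝ := fun i => i.elim 1 fun _ => Real.exp K with hM
  have hf_b : ∀ i q, |f i q| ≤ M i := by
    rintro (_ | m) q
    · simp only [hf, hFobs, hM, Option.elim]
      rw [abs_of_nonneg (indicator_smallFieldOn_mem_Icc _ I b _).1]
      exact (indicator_smallFieldOn_mem_Icc _ I b _).2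
    · simp only [hf, hFobs, hM, Option.elim]
      exact abs_boxObs_le hJI hγ (zero_le_one.trans hb) (m : B1Eq324BenfattoLemma.Site d) (hWb (m : B1Eq324BenfattoLemma.Site d)) _
  -- the geometry of the regions
  have hΩΓ : ∀ i, ∀ z ∈ Ω i, z ∉ Γ := by
    rintro (_ | m) z hz
    · exact not_mem_corridors_of_mem_out hz
    · exact fun hzΓ => Finset.disjoint_left.mp (disjoint_corridors_shrink hL w B (m : B1Eq324BenfattoLemma.Site d)) hzΓ
        (Finset.mem_coe.mp hz)
  have hΩenc : ∀ i, ∀ z ∈ Ω i, ∀ μ : Fin d,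
      (z + unitVec μ ∈ Ω i ∨ z + unitVec μ ∈ Γ) ∧ (z - unitVec μ ∈ Ω i ∨ z - unitVec μ ∈ Γ) := by
    rintro (_ | m)
    · exact out_enclosed hw B
    · exact shrink_enclosed hw (m : B1Eq324BenfattoLemma.Site d) (frame1_subset_corridors L w m.2)
  have hdisj : ∀ i j, i ≠ j → Disjoint (Ω i) (Ω j) := by
    have hos : ∀ m : B, Disjoint (out L B) (((shrink L (m : B1Eq324BenfattoLemma.Site d) w : Finset (B1Eq324BenfattoLemma.Site d)) :
        Set (B1Eq324BenfattoLemma.Site d))) := by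
      intro m
      rw [Set.disjoint_left]
      intro z hz hzs
      exact hz (m : B1Eq324BenfattoLemma.Site d) m.2 (shrink_subset_box L _ w (Finset.mem_coe.mp hzs))
    rintro (_ | m) (_ | m') hne
    · exact absurd rfl hne
    · exact hos m'
    · exact (hos m).symm
    · simp only [hΩ, Option.elim]
      rw [Finset.disjoint_coe]
      exact disjoint_shrink hL (fun h => hne (by rw [Subtype.ext h])) w w
  -- the integrand as `h(z|Γ)·Π_i f_i(z|Γ, z|Ω_i)`
  set G : (B1Eq324BenfattoLemma.Site d → ℝ) → ℝ := fun z => Hpre z * ∏ i, Fobs i z with hG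
  have hGeq' : ∀ z, G z = h (Γ.restrict z) * ∏ i, f i (Γ.restrict z, fun t : Ω i => z t) := by
    intro z
    simp only [hG, hf]
    rw [hF1 z]
    congr 1
    exact Finset.prod_congr rfl fun i _ => (hF2 i z).symm
  have hGstated : ∀ z, (smallFieldOn (Γ : Set (B1Eq324BenfattoLemma.Site d)) I (γ * b)).indicator (fun _ => (1 : ℝ)) z *
          Real.exp (hamiltonian s D κ a Γ z) *
        ((smallFieldOn (out L B) I b).indicator (fun _ => (1 : ℝ)) z *
          ∏ m ∈ B, (smallFieldOn (frame1 L w m : Set (B1Eq324BenfattoLemma.Site d)) I (γ * b)).indicator (fun _ => (1 : ℝ)) z *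
              (smallFieldOn (shrink L m w : Set (B1Eq324BenfattoLemma.Site d)) I b).indicator (fun _ => (1 : ℝ)) z * Real.exp (W m z))
      = G z := by
    intro z
    simp only [hG, hHpre, hFobs]
    rw [Fintype.prod_option]
    simp only [Option.elim]
    rw [Finset.prod_coe_sort B (fun m => (smallFieldOn (frame1 L w m : Set (B1Eq324BenfattoLemma.Site d)) I (γ * b)).indicator
        (fun _ => (1 : ℝ)) z * (smallFieldOn (shrink L m w : Set (B1Eq324BenfattoLemma.Site d)) I b).indicator (fun _ => (1 : ℝ)) z *
        Real.exp (W m z))]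
  -- (5.13)
  have h513 := integral_P0_prefactor_mul_prod_eq₂ hα hβ Γ hΩΓ hΩenc hdisj h hh_m hh_b f hf_m hf_b
  -- the inner integrals in glue-free form, a.s. under `P̄_ξ`
  have hinner : ∀ ξ i, ∫ z, f i (Γ.restrict ξ, fun t : Ω i => z t) ∂condField d α β Γ ξ = ∫ z, Fobs i z ∂condField d α β Γ ξ := by
    intro ξ i
    refine integral_congr_ae ?_
    filter_upwards [condField_ae_eqOn hα hβ Γ ξ] with z hz
    have hres : Γ.restrict ξ = Γ.restrict z := by
      funext c
      exact (hz c c.2).symm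
    simp only [hf]
    rw [hres]
    exact hF2 i z
  have hRHS : ∀ ξ, (smallFieldOn (Γ : Set (B1Eq324BenfattoLemma.Site d)) I (γ * b)).indicator (fun _ => (1 : ℝ)) ξ *
          Real.exp (hamiltonian s D κ a Γ ξ) *
        ((∫ z, (smallFieldOn (out L B) I b).indicator (fun _ => (1 : ℝ)) z ∂condField d α β Γ ξ) *
          ∏ m ∈ B, ∫ z, (smallFieldOn (frame1 L w m : Set (B1Eq324BenfattoLemma.Site d)) I (γ * b)).indicator (fun _ => (1 : ℝ)) z *
              (smallFieldOn (shrink L m w : Set (B1Eq324BenfattoLemma.Site d)) I b).indicator (fun _ => (1 : ℝ)) z *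
              Real.exp (W m z) ∂condField d α β Γ ξ)
      = h (Γ.restrict ξ) * ∏ i, (∫ z, f i (Γ.restrict ξ, fun t : Ω i => z t) ∂condField d α β Γ ξ) := by
    intro ξ
    rw [hF1 ξ, Fintype.prod_option, hinner ξ none, Finset.prod_congr rfl fun m _ => hinner ξ (some m)]
    have hcoe := Finset.prod_coe_sort B (fun m => ∫ z, (smallFieldOn (frame1 L w m : Set (B1Eq324BenfattoLemma.Site d)) I (γ * b)).indicator
        (fun _ => (1 : ℝ)) z * (smallFieldOn (shrink L m w : Set (B1Eq324BenfattoLemma.Site d)) I b).indicator (fun _ => (1 : ℝ)) z *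
        Real.exp (W m z) ∂condField d α β Γ ξ)
    rw [← hcoe]
    rfl
  calc _ = ∫ z, G z ∂P0 d α β := integral_congr_ae (Filter.Eventually.of_forall hGstated)
    _ = ∫ z, h (Γ.restrict z) * ∏ i, f i (Γ.restrict z, fun t : Ω i => z t) ∂P0 d α β :=
        integral_congr_ae (Filter.Eventually.of_forall hGeq')
    _ = _ := h513
    _ = _ := (integral_congr_ae (Filter.Eventually.of_forall hRHS)).symm

/-- **The product-over-boxes integrand is bounded and integrable.** [cite: BenfattoEtAl1978, (5.13) p.155] -/
theorem integrable_boxes_integrand (hα : 0 < α) (hβ : 0 < β) (hκ : 0 < κ) (hJ : CoefSupportedIn a J) (hA0 : 0 ≤ A)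
    (hA : ∀ p ∈ Finset.Icc 1 s, ∀ (Δ : Fin p → B1Eq324BenfattoLemma.Site d), (∀ i, Δ i ∈ J) →
      ∀ n ∈ admissible p D, |a p Δ n| ≤ A)
    (hJI : J ⊆ I) (B : Finset (B1Eq324BenfattoLemma.Site d)) (hγ : γ ≤ 1) (hb : 1 ≤ b)
    (W : B1Eq324BenfattoLemma.Site d → (B1Eq324BenfattoLemma.Site d → ℝ) → ℝ) (hWm : ∀ m, Measurable (W m)) {K : ℝ}
    (hWb : ∀ m, ∀ z : B1Eq324BenfattoLemma.Site d → ℝ, (∀ x ∈ J, x ∈ box L m → |z x| ≤ b) → |W m z| ≤ K) :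
    Integrable (fun z => (smallFieldOn (corridors L w B : Set (B1Eq324BenfattoLemma.Site d)) I (γ * b)).indicator (fun _ => (1 : ℝ)) z *
          Real.exp (hamiltonian s D κ a (corridors L w B) z) *
        ((smallFieldOn (out L B) I b).indicator (fun _ => (1 : ℝ)) z *
          ∏ m ∈ B, (smallFieldOn (frame1 L w m : Set (B1Eq324BenfattoLemma.Site d)) I (γ * b)).indicator (fun _ => (1 : ℝ)) z *
              (smallFieldOn (shrink L m w : Set (B1Eq324BenfattoLemma.Site d)) I b).indicator (fun _ => (1 : ℝ)) z * Real.exp (W m z)))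
      (P0 d α β) := by
  haveI : IsProbabilityMeasure (P0 d α β) := isProbabilityMeasure_P0 hα hβ
  refine Integrable.of_bound ?_ (Real.exp (s1Const s D d κ * A * b ^ D * (corridors L w B).card) * (1 * ∏ _m ∈ B, Real.exp K))
    (ae_of_all _ fun z => ?_)
  · refine (((measurable_indicator_smallFieldOn _ I (γ * b)).mul (measurable_hamiltonian _).exp).mul
      ((measurable_indicator_smallFieldOn _ I b).mul (Finset.measurable_prod _ fun m _ => ?_))).aestronglyMeasurable
    exact ((measurable_indicator_smallFieldOn _ I (γ * b)).mul (measurable_indicator_smallFieldOn _ I b)).mul (hWm m).exp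
  · rw [Real.norm_eq_abs, abs_mul]
    refine mul_le_mul (abs_corridorObs_le hκ hJ hA0 hA hJI hγ hb _ z) ?_ (abs_nonneg _) (Real.exp_pos _).le
    rw [abs_mul, Finset.abs_prod]
    refine mul_le_mul ?_ (Finset.prod_le_prod (fun m _ => abs_nonneg _)
      fun m _ => abs_boxObs_le hJI hγ (zero_le_one.trans hb) m (hWb m) z) (Finset.prod_nonneg fun m _ => abs_nonneg _) zero_le_one
    rw [abs_of_nonneg (indicator_smallFieldOn_mem_Icc _ I b z).1]
    exact (indicator_smallFieldOn_mem_Icc _ I b z).2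

end Main

/-! ## §6  (5.15) first line: `W_□ = Ψ_□` and the pointwise comparison with `Π_Δχ̂_Δ e^{Ĥ_J}` -/

section Eq515

variable {α β : ℝ} {s D : ℕ} {κ : ℝ} {a : Coef d} {J I : Finset (B1Eq324BenfattoLemma.Site d)} {L w : ℕ}
  {B : Finset (B1Eq324BenfattoLemma.Site d)} {γ b A : ℝ}

/-- `Ĥ_J` is measurable. [cite: BenfattoEtAl1978, (5.9) p.155] -/
theorem measurable_hatH (L w : ℕ) (B : Finset (B1Eq324BenfattoLemma.Site d)) : Measurable fun z => hatH s D κ a L w B z := by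
  unfold hatH
  exact (measurable_hamiltonian _).add (Finset.measurable_sum _ fun m _ => measurable_psiBox L w m)

/-- **`Π_Δχ̂_Δ·e^{Ĥ_J}` IS BOUNDED** by `exp(s₁Ab^D(|Γ₁| + 2|B|L^d))` (on the small-field set `|z_Δ| ≤ b` on `J ⊆ I`).
[cite: BenfattoEtAl1978, (5.11)–(5.12) p.155] -/
theorem abs_cutoffBoltzmann_hatH_le (hκ : 0 < κ) (hJ : CoefSupportedIn a J) (hA0 : 0 ≤ A)
    (hA : ∀ p ∈ Finset.Icc 1 s, ∀ (Δ : Fin p → B1Eq324BenfattoLemma.Site d), (∀ i, Δ i ∈ J) →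
      ∀ n ∈ admissible p D, |a p Δ n| ≤ A)
    (hJI : J ⊆ I) (hb : 1 ≤ b) (L w : ℕ) (B : Finset (B1Eq324BenfattoLemma.Site d)) (z : B1Eq324BenfattoLemma.Site d → ℝ) :
    |cutoffBoltzmann (hatH s D κ a L w B) I b z| ≤
      Real.exp (s1Const s D d κ * A * b ^ D * ((corridors L w B).card + 2 * B.card * (L : ℝ) ^ d)) := by
  rw [cutoffBoltzmann]
  by_cases hz : z ∈ smallFieldSet I b
  swap
  · rw [Set.indicator_of_notMem hz, abs_zero]
    exact (Real.exp_pos _).le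
  rw [Set.indicator_of_mem hz, Real.abs_exp, Real.exp_le_exp]
  have hzJ : ∀ x ∈ J, |z x| ≤ b := fun x hx => by
    have h := hz x
    rwa [distToRegion_eq_zero_of_mem (hJI hx), add_zero, mul_one] at h
  refine (le_abs_self _).trans ?_
  rw [hatH]
  refine (abs_add_le _ _).trans ?_
  have h1 := abs_hamiltonian_le hκ hJ hA0 hA (corridors L w B) hb hzJ (s := s) (D := D)
  have h2 : |∑ m ∈ B, psiBox s D κ a L w m z| ≤ B.card * (2 * s1Const s D d κ * A * b ^ D * (L : ℝ) ^ d) := by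
    refine (Finset.abs_sum_le_sum_abs _ _).trans ?_
    calc ∑ m ∈ B, |psiBox s D κ a L w m z| ≤ ∑ _m ∈ B, 2 * s1Const s D d κ * A * b ^ D * (L : ℝ) ^ d :=
          Finset.sum_le_sum fun m _ => abs_psiBox_le hκ hJ hA0 hA hb hzJ
      _ = _ := by rw [Finset.sum_const, nsmul_eq_mul]
  calc |hamiltonian s D κ a (corridors L w B) z| + |∑ m ∈ B, psiBox s D κ a L w m z|
      ≤ s1Const s D d κ * A * b ^ D * (corridors L w B).card + B.card * (2 * s1Const s D d κ * A * b ^ D * (L : ℝ) ^ d) := add_le_add h1 h2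
    _ = _ := by ring

/-- **The pointwise comparison of (5.15)**: `χ^{Γ₁}_{γb}e^{H_{Γ₁}}·χ^{out}_b·Π_□(χ^{Γ₁(□)}_{γb}χ^□_b e^{Ψ_□}) ≤ Π_Δχ̂_Δ·e^{Ĥ_J}` (the cut-offs by §1,
`e^{Ĥ_J} = e^{H_{Γ₁}}Π_□e^{Ψ_□}`). [cite: BenfattoEtAl1978, (5.14)–(5.15) p.155] -/
theorem boxes_integrand_psiBox_le_cutoffBoltzmann (L w : ℕ) (B : Finset (B1Eq324BenfattoLemma.Site d))
    (I : Finset (B1Eq324BenfattoLemma.Site d)) (hγ : γ ≤ 1) (hb : 0 ≤ b) (z : B1Eq324BenfattoLemma.Site d → ℝ) :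
    (smallFieldOn (corridors L w B : Set (B1Eq324BenfattoLemma.Site d)) I (γ * b)).indicator (fun _ => (1 : ℝ)) z *
          Real.exp (hamiltonian s D κ a (corridors L w B) z) *
        ((smallFieldOn (out L B) I b).indicator (fun _ => (1 : ℝ)) z *
          ∏ m ∈ B, (smallFieldOn (frame1 L w m : Set (B1Eq324BenfattoLemma.Site d)) I (γ * b)).indicator (fun _ => (1 : ℝ)) z *
              (smallFieldOn (shrink L m w : Set (B1Eq324BenfattoLemma.Site d)) I b).indicator (fun _ => (1 : ℝ)) z *
              Real.exp (psiBox s D κ a L w m z))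
      ≤ cutoffBoltzmann (hatH s D κ a L w B) I b z := by
  have hF : cutoffBoltzmann (hatH s D κ a L w B) I b z = (smallFieldSet I b).indicator (fun _ => (1 : ℝ)) z * Real.exp (hatH s D κ a L w B z) := by
    rw [cutoffBoltzmann]
    by_cases hz : z ∈ smallFieldSet I b
    · rw [Set.indicator_of_mem hz, Set.indicator_of_mem hz, one_mul]
    · rw [Set.indicator_of_notMem hz, Set.indicator_of_notMem hz, zero_mul]
  rw [hF, exp_hatH_eq]
  have hGeq : (smallFieldOn (corridors L w B : Set (B1Eq324BenfattoLemma.Site d)) I (γ * b)).indicator (fun _ => (1 : ℝ)) z *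
          Real.exp (hamiltonian s D κ a (corridors L w B) z) *
        ((smallFieldOn (out L B) I b).indicator (fun _ => (1 : ℝ)) z *
          ∏ m ∈ B, (smallFieldOn (frame1 L w m : Set (B1Eq324BenfattoLemma.Site d)) I (γ * b)).indicator (fun _ => (1 : ℝ)) z *
              (smallFieldOn (shrink L m w : Set (B1Eq324BenfattoLemma.Site d)) I b).indicator (fun _ => (1 : ℝ)) z *
              Real.exp (psiBox s D κ a L w m z))
      = ((smallFieldOn (corridors L w B : Set (B1Eq324BenfattoLemma.Site d)) I (γ * b)).indicator (fun _ => (1 : ℝ)) z *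
        ((smallFieldOn (out L B) I b).indicator (fun _ => (1 : ℝ)) z *
          ∏ m ∈ B, (smallFieldOn (shrink L m w : Set (B1Eq324BenfattoLemma.Site d)) I b).indicator (fun _ => (1 : ℝ)) z)) *
        (∏ m ∈ B, (smallFieldOn (frame1 L w m : Set (B1Eq324BenfattoLemma.Site d)) I (γ * b)).indicator (fun _ => (1 : ℝ)) z) *
        (Real.exp (hamiltonian s D κ a (corridors L w B) z) * ∏ m ∈ B, Real.exp (psiBox s D κ a L w m z)) := by
    rw [Finset.prod_mul_distrib, Finset.prod_mul_distrib]
    ring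
  rw [hGeq]
  have hP := prod_indicator_le_indicator_smallFieldSet L w B I (b := b) hγ hb z
  have hQ1 : ∏ m ∈ B, (smallFieldOn (frame1 L w m : Set (B1Eq324BenfattoLemma.Site d)) I (γ * b)).indicator (fun _ => (1 : ℝ)) z ≤ 1 :=
    Finset.prod_le_one (fun m _ => (indicator_smallFieldOn_mem_Icc _ I _ z).1) fun m _ => (indicator_smallFieldOn_mem_Icc _ I _ z).2
  have hQ0 : 0 ≤ ∏ m ∈ B, (smallFieldOn (frame1 L w m : Set (B1Eq324BenfattoLemma.Site d)) I (γ * b)).indicator (fun _ => (1 : ℝ)) z :=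
    Finset.prod_nonneg fun m _ => (indicator_smallFieldOn_mem_Icc _ I _ z).1
  have hE0 : 0 ≤ Real.exp (hamiltonian s D κ a (corridors L w B) z) * ∏ m ∈ B, Real.exp (psiBox s D κ a L w m z) :=
    mul_nonneg (Real.exp_pos _).le (Finset.prod_nonneg fun m _ => (Real.exp_pos _).le)
  have hS0 : 0 ≤ (smallFieldSet I b).indicator (fun _ => (1 : ℝ)) z := Set.indicator_nonneg (fun _ _ => zero_le_one) _
  calc _ ≤ (smallFieldSet I b).indicator (fun _ => (1 : ℝ)) z * 1 *
        (Real.exp (hamiltonian s D κ a (corridors L w B) z) * ∏ m ∈ B, Real.exp (psiBox s D κ a L w m z)) :=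
        mul_le_mul_of_nonneg_right (mul_le_mul hP hQ1 hQ0 hS0) hE0
    _ = _ := by rw [mul_one]

/-- **(5.13) + THE FIRST LINE OF (5.15) — THE FACTORISED LOWER BOUND**: p. 155, *"[(5.12)] ≧ ∫P̄(dz_{Γ₁})χ^{Γ₁}_{γb} exp H_{Γ₁}(Π_{□∩J=∅}∫P̄(dz_□|z_{Γ₁})χ^□_b)·
(Π_{□∩J≠∅}∫P̄(dz_□|z_{Γ₁})χ^□_b exp Ψ_□χ^□_b) (5.15)"*.  PROVED for the tree's objects (`α, β > 0`, `L ≥ 1`, `w ≥ 1`, `γ ≤ 1`, `b ≥ 1`, `J ⊆ I`, the extension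
convention with `|A^{n}_{Δ}| ≤ A` on the range of (4.5)): with `Γ₁ = corridors L w B`, `P̄_ξ = condField d α β Γ₁ ξ` and the far region `out L B`
carrying a pure cut-off (print's `Π_{□∩J=∅}`),
`∫ χ^{Γ₁}_{γb}(ξ) e^{H_{Γ₁}(ξ)}·[∫ χ^{out}_b dP̄_ξ]·Π_{□∈B}[∫ χ^{Γ₁(□)}_{γb}(z) χ^□_b(z) e^{Ψ_□(z)} dP̄_ξ(z)] dP̂₀(ξ) ≤ ∫ Π_Δχ̂_Δ e^{Ĥ_J} dP̂₀`
(the factor `χ^{Γ₁(□)}_{γb}(z)`, equal to `1` a.s. on the prefactor's support, is kept because the per-box estimates (5.15) i)–(5.33) use the bound on the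
corridor values).  `integral_boxes_factorise_eq` with `W_□ = Ψ_□` + the pointwise comparison + monotonicity of the integral.
[cite: BenfattoEtAl1978, §5 (5.12)–(5.15) p.155] -/
theorem integral_cutoff_exp_hatH_ge (hα : 0 < α) (hβ : 0 < β) (hκ : 0 < κ) (hJ : CoefSupportedIn a J) (hA0 : 0 ≤ A)
    (hA : ∀ p ∈ Finset.Icc 1 s, ∀ (Δ : Fin p → B1Eq324BenfattoLemma.Site d), (∀ i, Δ i ∈ J) →
      ∀ n ∈ admissible p D, |a p Δ n| ≤ A)
    (hJI : J ⊆ I) (hL : 0 < L) (hw : 1 ≤ w) (B : Finset (B1Eq324BenfattoLemma.Site d)) (hγ : γ ≤ 1) (hb : 1 ≤ b) :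
    ∫ ξ, (smallFieldOn (corridors L w B : Set (B1Eq324BenfattoLemma.Site d)) I (γ * b)).indicator (fun _ => (1 : ℝ)) ξ *
          Real.exp (hamiltonian s D κ a (corridors L w B) ξ) *
        ((∫ z, (smallFieldOn (out L B) I b).indicator (fun _ => (1 : ℝ)) z ∂condField d α β (corridors L w B) ξ) *
          ∏ m ∈ B, ∫ z, (smallFieldOn (frame1 L w m : Set (B1Eq324BenfattoLemma.Site d)) I (γ * b)).indicator (fun _ => (1 : ℝ)) z *
              (smallFieldOn (shrink L m w : Set (B1Eq324BenfattoLemma.Site d)) I b).indicator (fun _ => (1 : ℝ)) z *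
              Real.exp (psiBox s D κ a L w m z) ∂condField d α β (corridors L w B) ξ) ∂P0 d α β
      ≤ ∫ z, cutoffBoltzmann (hatH s D κ a L w B) I b z ∂P0 d α β := by
  haveI : IsProbabilityMeasure (P0 d α β) := isProbabilityMeasure_P0 hα hβ
  have hWb : ∀ m, ∀ z : B1Eq324BenfattoLemma.Site d → ℝ, (∀ x ∈ J, x ∈ box L m → |z x| ≤ b) →
      |psiBox s D κ a L w m z| ≤ 2 * s1Const s D d κ * A * b ^ D * (L : ℝ) ^ d := fun m z hz => abs_psiBox_le_local hκ hJ hA0 hA hb hz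
  rw [← integral_boxes_factorise_eq hα hβ hκ hJ hA0 hA hJI hL hw B hγ hb (fun m => psiBox s D κ a L w m)
    (fun m z z' h => psiBox_congr_eqOn L w m h) (fun m => measurable_psiBox L w m) hWb]
  have hFint : Integrable (fun z => cutoffBoltzmann (hatH s D κ a L w B) I b z) (P0 d α β) := by
    refine Integrable.of_bound ?_ (Real.exp (s1Const s D d κ * A * b ^ D * ((corridors L w B).card + 2 * B.card * (L : ℝ) ^ d)))
      (ae_of_all _ fun z => ?_)
    · rw [cutoffBoltzmann]
      exact ((measurable_hatH L w B).exp.indicator (measurableSet_smallFieldSet I b)).aestronglyMeasurable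
    · rw [Real.norm_eq_abs]
      exact abs_cutoffBoltzmann_hatH_le hκ hJ hA0 hA hJI hb L w B z
  refine integral_mono_of_nonneg (Filter.Eventually.of_forall fun z => ?_) hFint
    (Filter.Eventually.of_forall fun z => boxes_integrand_psiBox_le_cutoffBoltzmann L w B I hγ (zero_le_one.trans hb) z)
  refine mul_nonneg (mul_nonneg (indicator_smallFieldOn_mem_Icc _ I _ z).1 (Real.exp_pos _).le)
    (mul_nonneg (indicator_smallFieldOn_mem_Icc _ I _ z).1 (Finset.prod_nonneg fun m _ => ?_))
  exact mul_nonneg (mul_nonneg (indicator_smallFieldOn_mem_Icc _ I _ z).1 (indicator_smallFieldOn_mem_Icc _ I _ z).1) (Real.exp_pos _).le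

end Eq515


end Literature.MathematicalPhysics.QuantumFieldTheory.Balaban1983to89.B1Eq324BenfattoSect5Eq515

end
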